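import Summits.CriticalPhenomena.PercolationContinuityZ3.Theorems.FK.InfiniteVolumeDLRPositiveAssociation
import Summits.CriticalPhenomena.PercolationContinuityZ3.Theorems.FK.InfiniteVolumeTailTrivial
import Summits.CriticalPhenomena.PercolationContinuityZ3.Theorems.FK.InfiniteVolumeFKG
import Mathlib.MeasureTheory.Measure.Decomposition.IntegralRNDeriv
import HarnessLib

/-!
# FK-continuity transplant, FO-06/FO-10 (infinite-volume structure): TAIL-TRIVIAL members of `R_{p,q}` — they are
# EXTREMAL (Georgii 2011, Thm. 7.7 (b) ⇒ (a)/(c)/(d); Grimmett 2006, proof of Thm. (4.34)(c)) and POSITIVELY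
# ASSOCIATED on all increasing events (Prop. (4.37)(c) as `IsPositivelyAssociated`)

Registered R88 (cell INBOX l.6337, 2026-08-24); registry row FO-10b-g408e; label DXT-A (coordinator fk-4 g193).
Cell `fk-continuity` (bschramm), FO-10b lineage; support file for the FK-continuity transplant
(`--supports stmt-CriticalPhenomena-4575`); builds on p205010 (kernel theorem, internal audit signed; external expert
review pending). No named facts, no definitions, no sorries, standard axioms. Banked infinite-volume structure; not an
END-STATE dependency of the cell (not consumed by `_r3`); it says nothing about FH / TP_FK or continuity at `p_c`.

For `P ∈ R_{p,q}` (`IsDLRRandomCluster d p q P`, `0 ≤ p ≤ 1`, `q > 0`) and a finite region `Λ` with outside σ-algebra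
`𝒯_Λ = outsideEvents d Λ`:

* `IsDLRRandomCluster.rnDeriv_toReal_ae_eq_condExp` — for `P₁, P ∈ R_{p,q}` with `P₁ ≤ c P`, the density
  `f = dP₁/dP` satisfies `f = P[f | 𝒯_Λ]` a.s. for EVERY finite region `Λ` (Georgii 2011, (7.3)/Thm. 7.7 proof:
  `P₁(A) = ∫ φ^ξ_Λ(A) f(ξ) P(dξ) = ∫ P[1_A|𝒯_Λ] P[f|𝒯_Λ] dP = ∫_A P[f|𝒯_Λ] dP`);
* **`IsDLRRandomCluster.eq_of_le_smul_of_isTailTrivial`** — **tail-trivial ⇒ extremal**: if `P ∈ R_{p,q}` is carried by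
  lattice configurations and TAIL-TRIVIAL, and `P₁ ∈ R_{p,q}` satisfies `P₁ ≤ c • P` for some finite `c`, then
  `P₁ = P`.  (Lévy's downward theorem along `𝒯_{Λ_n}`, `InfiniteVolumeDLRTailLimit.lean`: `f = P[f | ⋂_n 𝒯_{Λ_n}] = 1`
  a.s.)  `IsDLRRandomCluster.eq_of_eq_add_smul_of_isTailTrivial` — hence a tail-trivial member of `R_{p,q}` admits
  no non-trivial decomposition `P = a P₁ + b P₂` inside `R_{p,q}` (with `InfiniteVolumeDLRTailConditioning.lean`:
  Georgii's Thm. 7.7 for `R_{p,q}`, "tail-triviality is equivalent to extremality", GRC proof of (4.34)(c));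
* `IsDLRRandomCluster.exists_tailEvents_measure_eq_one_and_eq_zero_of_ne` — Georgii's Thm. 7.7 (d): two DISTINCT
  tail-trivial members of `R_{p,q}` are separated by a tail event (`P(B) = 1`, `P'(B) = 0`);
* `IsBoxLimit.eq_of_isDLRRandomCluster_of_le_smul`, `eq_rcLimit_of_isDLRRandomCluster_of_le_smul` — Grimmett's
  Thm. (4.34)(c) inside `R_{p,q}` in domination form: a DLR measure `≤ c • φ^b_{p,q}` is `φ^b_{p,q}` (`q ≥ 1`; the box
  limits are tail-trivial by FO-06a-6 `IsBoxLimit.isTailTrivial`);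
* `isPositivelyAssociated_of_forall_edgesIn`, **`IsDLRRandomCluster.isPositivelyAssociated_of_isTailTrivial`** —
  **Prop. (4.37)(c) in the tree's vocabulary**: a tail-trivial `P ∈ R_{p,q}` carried by lattice configurations
  (`q ≥ 1`) is `IsPositivelyAssociated` (ALL measurable increasing events), from the `E_Δ`-local form by the lattice
  reduction `ω ↦ ω ∩ 𝔼^d` and Lindqvist's cylinder criterion (`isPositivelyAssociated_pi_of_cylinders`).

## References

* H.-O. Georgii, *Gibbs Measures and Phase Transitions*, 2nd ed., de Gruyter 2011, Thm. 7.7 with (7.3), Prop. 7.9. [Georgii2011]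
* G. Grimmett, *The Random-Cluster Model*, Springer 2006: Def. (4.29)–(4.30), Thm. (4.34)(c) and its proof, pp. 81–82, 86. [Grimmett2006]
* R. Durrett, *Probability: Theory and Examples*, 5th ed., CUP 2019, Thm. 4.7.3. [Durrett2019]
* B. H. Lindqvist, J. Appl. Probab. 25 (1988), Thm. 5.1. [Lindqvist1988]
-/

noncomputable section

open MeasureTheory ProbabilityTheory Filter Set Finset

open scoped Topology ENNReal ProbabilityTheory

namespace Summit.CriticalPhenomena.PercolationContinuityZ3.Theorems.FK

open Literature.Probability.Percolation Literature.Probability.LatticeModels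

variable {d : ℕ} {p q : ℝ} {P : Measure (BondConfig (Site d))}

namespace IsDLRRandomCluster

variable {P₁ : Measure (BondConfig (Site d))}

/-- **The density of a dominated DLR measure is `𝒯_Λ`-measurable up to null sets, for every `Λ`** (Georgii 2011,
(7.3) / proof of Thm. 7.7): for `P, P₁ ∈ R_{p,q}` (`0 ≤ p ≤ 1`, `q > 0`) with `P₁ ≤ c • P` (`c < ∞`) and
`f = dP₁/dP`, one has `f = P[f | 𝒯_Λ]` `P`-a.s.  Proof: for measurable `A`,
`∫_A f dP = P₁(A) = ∫ φ^ξ_Λ(A) dP₁ = ∫ φ^ξ_Λ(A) f dP = ∫ P[1_A|𝒯_Λ] P[f|𝒯_Λ] dP = ∫_A P[f|𝒯_Λ] dP` (DLR for `P₁`,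
(4.30) for `P`, and two pull-outs). [cite: Georgii2011, Thm. 7.7] -/
theorem rnDeriv_toReal_ae_eq_condExp (hP : IsDLRRandomCluster d p q P) (h₁ : IsDLRRandomCluster d p q P₁)
    (hp : p ∈ Set.Icc (0 : ℝ) 1) (hq : 0 < q) {c : ℝ≥0∞} (hc : c ≠ ∞) (hdom : P₁ ≤ c • P) (Λ : Finset (Site d)) :
    (fun ω => (P₁.rnDeriv P ω).toReal) =ᵐ[P]
      P[(fun ω => (P₁.rnDeriv P ω).toReal) | outsideEvents d Λ] := by
  haveI := hP.isProbabilityMeasure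
  haveI := h₁.isProbabilityMeasure
  have hac : P₁ ≪ P := Measure.absolutelyContinuous_of_le_smul hdom
  set f : BondConfig (Site d) → ℝ := fun ω => (P₁.rnDeriv P ω).toReal with hf
  have hf_int : Integrable f P := Measure.integrable_toReal_rnDeriv
  -- `f` is bounded by `c`
  have hρle : P₁.rnDeriv P ≤ᵐ[P] fun _ => c := by
    refine ae_le_of_forall_setLIntegral_le_of_sigmaFinite (Measure.measurable_rnDeriv _ _) fun s hs _ => ?_
    rw [Measure.setLIntegral_rnDeriv hac s, setLIntegral_const]
    calc P₁ s ≤ (c • P) s := hdom s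
      _ = c * P s := by rw [Measure.smul_apply, smul_eq_mul]
  have hf_bdd : ∀ᵐ ω ∂P, |f ω| ≤ c.toReal := by
    filter_upwards [hρle] with ω hω
    rw [hf, abs_of_nonneg ENNReal.toReal_nonneg]
    exact ENNReal.toReal_mono hc hω
  have hmle := outsideEvents_le (d := d) Λ
  -- the two sides have the same integral over every measurable set
  refine (Integrable.ae_eq_of_forall_setIntegral_eq _ _ hf_int integrable_condExp fun A hA _ => ?_)
  -- `∫_A f dP = P₁(A)`
  rw [Measure.setIntegral_toReal_rnDeriv hac A]
  -- `∫_A P[f|𝒯] dP = ∫ P[1_A|𝒯] · P[f|𝒯] dP = ∫ φ^·_Λ(A) · P[f|𝒯] dP = ∫ φ^·_Λ(A) · f dP = ∫ φ^·_Λ(A) dP₁ = P₁(A)`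
  set κ : BondConfig (Site d) → ℝ := fun ξ => (rcCondLaw p q Λ ξ A).toReal with hκ
  have hκm : StronglyMeasurable[outsideEvents d Λ] κ :=
    ((measurable_rcCondLaw_apply_outsideEvents p q Λ hA).ennreal_toReal).stronglyMeasurable
  have hκbdd : ∀ ξ, ‖κ ξ‖ ≤ 1 := fun ξ => by
    rw [hκ, Real.norm_eq_abs, abs_of_nonneg ENNReal.toReal_nonneg]
    exact ENNReal.toReal_le_of_le_ofReal zero_le_one
      (by rw [ENNReal.ofReal_one]; exact rcCondLaw_apply_le_one hp hq Λ ξ hA)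
  have hκae : κ =ᵐ[P] P[A.indicator (fun _ => (1 : ℝ)) | outsideEvents d Λ] :=
    hP.toReal_rcCondLaw_ae_eq_condExp_indicator hp hq Λ hA
  have hcf_int : Integrable (P[f|outsideEvents d Λ]) P := integrable_condExp
  have hcf_sm : StronglyMeasurable[outsideEvents d Λ] (P[f|outsideEvents d Λ]) := stronglyMeasurable_condExp
  -- (i) `∫_A P[f|𝒯] = ∫ 1_A * P[f|𝒯] = ∫ P[1_A * P[f|𝒯] | 𝒯] = ∫ P[1_A|𝒯] * P[f|𝒯]`
  have h1A_int : Integrable (A.indicator fun _ => (1 : ℝ)) P := (integrable_const (1 : ℝ)).indicator hA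
  have hprod1 : Integrable (fun ω => A.indicator (fun _ => (1 : ℝ)) ω * (P[f|outsideEvents d Λ]) ω) P := by
    refine hcf_int.bdd_mul (c := 1) h1A_int.aestronglyMeasurable (ae_of_all _ fun ω => ?_)
    by_cases hω : ω ∈ A
    · simp [Set.indicator_of_mem hω]
    · simp [Set.indicator_of_notMem hω]
  have hstep1 : ∫ ω in A, (P[f|outsideEvents d Λ]) ω ∂P = ∫ ω, (P[A.indicator (fun _ => (1 : ℝ)) | outsideEvents d Λ]) ω * (P[f|outsideEvents d Λ]) ω ∂P := by
    have hpull : P[(fun ω => A.indicator (fun _ => (1 : ℝ)) ω * (P[f|outsideEvents d Λ]) ω) | outsideEvents d Λ] =ᵐ[P]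
        fun ω => (P[A.indicator (fun _ => (1 : ℝ)) | outsideEvents d Λ]) ω * (P[f|outsideEvents d Λ]) ω :=
      condExp_mul_of_stronglyMeasurable_right hcf_sm hprod1 h1A_int
    calc ∫ ω in A, (P[f|outsideEvents d Λ]) ω ∂P = ∫ ω, A.indicator (fun _ => (1 : ℝ)) ω * (P[f|outsideEvents d Λ]) ω ∂P := by
          rw [← integral_indicator hA]
          refine integral_congr_ae (ae_of_all _ fun ω => ?_)
          by_cases hω : ω ∈ A
          · simp [Set.indicator_of_mem hω]
          · simp [Set.indicator_of_notMem hω]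
      _ = ∫ ω, (P[(fun ω => A.indicator (fun _ => (1 : ℝ)) ω * (P[f|outsideEvents d Λ]) ω) | outsideEvents d Λ]) ω ∂P :=
          (integral_condExp hmle).symm
      _ = ∫ ω, (P[A.indicator (fun _ => (1 : ℝ)) | outsideEvents d Λ]) ω * (P[f|outsideEvents d Λ]) ω ∂P := integral_congr_ae hpull
  -- (ii) `= ∫ κ * P[f|outsideEvents d Λ] = ∫ P[κ * f | outsideEvents d Λ] = ∫ κ * f`
  have hprod2 : Integrable (fun ω => κ ω * f ω) P :=
    hf_int.bdd_mul (c := 1) (hκm.mono hmle).aestronglyMeasurable (ae_of_all _ hκbdd)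
  have hstep2 : ∫ ω, (P[A.indicator (fun _ => (1 : ℝ)) | outsideEvents d Λ]) ω * (P[f|outsideEvents d Λ]) ω ∂P = ∫ ω, κ ω * f ω ∂P := by
    have hpull : P[(fun ω => κ ω * f ω) | outsideEvents d Λ] =ᵐ[P] fun ω => κ ω * (P[f|outsideEvents d Λ]) ω :=
      condExp_mul_of_stronglyMeasurable_left hκm hprod2 hf_int
    calc ∫ ω, (P[A.indicator (fun _ => (1 : ℝ)) | outsideEvents d Λ]) ω * (P[f|outsideEvents d Λ]) ω ∂P = ∫ ω, κ ω * (P[f|outsideEvents d Λ]) ω ∂P := by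
          refine integral_congr_ae ?_
          filter_upwards [hκae] with ω hω
          rw [hω]
      _ = ∫ ω, (P[(fun ω => κ ω * f ω) | outsideEvents d Λ]) ω ∂P := (integral_congr_ae hpull).symm
      _ = ∫ ω, κ ω * f ω ∂P := integral_condExp hmle
  -- (iii) `∫ κ * f dP = ∫ κ dP₁ = P₁(A)` (density, then the DLR equation for `P₁`)
  have hstep3 : ∫ ω, κ ω * f ω ∂P = P₁.real A := by
    have h := integral_toReal_rnDeriv_mul hac (f := κ)
    have hswap : ∫ ω, κ ω * f ω ∂P = ∫ ω, (P₁.rnDeriv P ω).toReal * κ ω ∂P :=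
      integral_congr_ae (ae_of_all _ fun ω => by rw [hf]; ring)
    rw [hswap, h, hκ, integral_toReal ((measurable_rcCondLaw_apply_outsideEvents p q Λ hA).mono hmle
        le_rfl).aemeasurable (ae_of_all _ fun ξ => (rcCondLaw_apply_le_one hp hq Λ ξ hA).trans_lt ENNReal.one_lt_top),
      h₁.lintegral_rcCondLaw_eq Λ hA, measureReal_def]
  rw [hstep1, hstep2, hstep3]

/-- **Tail-trivial DLR random-cluster measures are extremal** (Georgii 2011, Thm. 7.7 (b) ⇒ (c); quoted in Grimmett
2006, proof of Thm. (4.34)(c)): let `P ∈ R_{p,q}` (`0 ≤ p ≤ 1`, `q > 0`) be carried by lattice configurations and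
TAIL-TRIVIAL, and let `P₁ ∈ R_{p,q}` be dominated by `P`, `P₁ ≤ c • P` with `c < ∞`.  Then `P₁ = P`.  Proof: the density
`f = dP₁/dP` equals `P[f | 𝒯_{Λ_n}]` a.s. for the boxes `Λ_n` (`rnDeriv_toReal_ae_eq_condExp`), these converge a.s.
along a subsequence to `P[f | ⋂_n 𝒯_{Λ_n}]` (Lévy's downward theorem), which is the constant `P₁(Ω) = 1` because `P` is
`0/1`-valued on `⋂_n 𝒯_{Λ_n}` (tail-triviality + lattice support); so `f = 1` a.s. [cite: Georgii2011, Thm. 7.7] -/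
theorem eq_of_le_smul_of_isTailTrivial (hP : IsDLRRandomCluster d p q P) (hp : p ∈ Set.Icc (0 : ℝ) 1) (hq : 0 < q)
    (hlat : ∀ᵐ ω ∂P, ω ⊆ (zdGraph d).edgeSet) (htail : IsTailTrivial (V := Sym2 (Site d)) (S := Prop) P)
    (h₁ : IsDLRRandomCluster d p q P₁) {c : ℝ≥0∞} (hc : c ≠ ∞) (hdom : P₁ ≤ c • P) : P₁ = P := by
  haveI := hP.isProbabilityMeasure
  haveI := h₁.isProbabilityMeasure
  have hac : P₁ ≪ P := Measure.absolutelyContinuous_of_le_smul hdom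
  set f : BondConfig (Site d) → ℝ := fun ω => (P₁.rnDeriv P ω).toReal with hf
  have hf_int : Integrable f P := Measure.integrable_toReal_rnDeriv
  have hρle : P₁.rnDeriv P ≤ᵐ[P] fun _ => c := by
    refine ae_le_of_forall_setLIntegral_le_of_sigmaFinite (Measure.measurable_rnDeriv _ _) fun s hs _ => ?_
    rw [Measure.setLIntegral_rnDeriv hac s, setLIntegral_const]
    calc P₁ s ≤ (c • P) s := hdom s
      _ = c * P s := by rw [Measure.smul_apply, smul_eq_mul]
  have hf_bdd : ∀ᵐ ω ∂P, |f ω| ≤ c.toReal := by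
    filter_upwards [hρle] with ω hω
    rw [hf, abs_of_nonneg ENNReal.toReal_nonneg]
    exact ENNReal.toReal_mono hc hω
  -- the outside σ-algebras of the boxes
  set ℱ : ℕ → MeasurableSpace (BondConfig (Site d)) := fun n => outsideEvents d (box d n) with hℱ
  have hanti : Antitone ℱ := antitone_outsideEvents (box_mono d)
  have hle : ∀ n, ℱ n ≤ (inferInstance : MeasurableSpace (BondConfig (Site d))) := fun n => outsideEvents_le _
  obtain ⟨φ, -, hlim⟩ :=
    Literature.Probability.Process.exists_strictMono_ae_tendsto_condExp_antitone hanti hle hf_int hf_bdd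
  have hfix : ∀ j, f =ᵐ[P] P[f|ℱ (φ j)] := fun j => hP.rnDeriv_toReal_ae_eq_condExp h₁ hp hq hc hdom (box d (φ j))
  have htriv : ∀ s, MeasurableSet[⨅ n, ℱ n] s → P s = 0 ∨ P s = 1 := fun s hs =>
    measure_eq_zero_or_one_of_isTailTrivial_of_measurableSet_iInf_outsideEvents htail hlat (fun _ => le_rfl) hs
  have hconst : P[f|⨅ n, ℱ n] =ᵐ[P] fun _ => ∫ x, f x ∂P :=
    condExp_ae_eq_integral_of_forall_measure_eq_zero_or_one ((iInf_le ℱ 0).trans (hle 0)) htriv hf_int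
  have hone : ∫ x, f x ∂P = 1 := by
    rw [hf, Measure.integral_toReal_rnDeriv hac, probReal_univ]
  -- `f = 1` a.s.
  have hf1 : f =ᵐ[P] fun _ => (1 : ℝ) := by
    filter_upwards [hlim, ae_all_iff.2 hfix, hconst] with ω hω hωfix hωc
    have hcst : Tendsto (fun j => (P[f|ℱ (φ j)]) ω) atTop (𝓝 (f ω)) := by
      have : (fun j => (P[f|ℱ (φ j)]) ω) = fun _ => f ω := funext fun j => (hωfix j).symm
      rw [this]
      exact tendsto_const_nhds
    rw [tendsto_nhds_unique hcst hω, hωc, hone]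
  -- hence `dP₁/dP = 1` a.s. and `P₁ = P`
  have hρ1 : P₁.rnDeriv P =ᵐ[P] fun _ => (1 : ℝ≥0∞) := by
    filter_upwards [hf1, Measure.rnDeriv_lt_top P₁ P] with ω hω hωtop
    exact (ENNReal.toReal_eq_one_iff _).1 hω
  calc P₁ = P.withDensity (P₁.rnDeriv P) := (Measure.withDensity_rnDeriv_eq _ _ hac).symm
    _ = P.withDensity (fun _ => 1) := withDensity_congr_ae hρ1
    _ = P := by rw [show (fun _ : BondConfig (Site d) => (1 : ℝ≥0∞)) = 1 from rfl, withDensity_one]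

/-- **Tail-trivial ⇒ extreme point of `R_{p,q}`** (Georgii 2011, Thm. 7.7 (b) ⇒ (a)): if `P ∈ R_{p,q}` (`0 ≤ p ≤ 1`,
`q > 0`) is carried by lattice configurations and tail-trivial, and `P = a • P₁ + b • P₂` with `P₁, P₂ ∈ R_{p,q}` and
`a ≠ 0`, then `P₁ = P`. [cite: Georgii2011, Thm. 7.7] -/
theorem eq_of_eq_add_smul_of_isTailTrivial (hP : IsDLRRandomCluster d p q P) (hp : p ∈ Set.Icc (0 : ℝ) 1)
    (hq : 0 < q) (hlat : ∀ᵐ ω ∂P, ω ⊆ (zdGraph d).edgeSet) (htail : IsTailTrivial (V := Sym2 (Site d)) (S := Prop) P)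
    {P₂ : Measure (BondConfig (Site d))} (h₁ : IsDLRRandomCluster d p q P₁) {a b : ℝ≥0∞} (ha : a ≠ 0)
    (ha' : a ≠ ∞) (hdec : P = a • P₁ + b • P₂) : P₁ = P := by
  refine hP.eq_of_le_smul_of_isTailTrivial hp hq hlat htail h₁ (c := a⁻¹) (ENNReal.inv_ne_top.2 ha) ?_
  intro s
  rw [Measure.smul_apply, smul_eq_mul, hdec, Measure.add_apply, Measure.smul_apply, Measure.smul_apply, smul_eq_mul,
    smul_eq_mul, mul_add, ← mul_assoc, ENNReal.inv_mul_cancel ha ha', one_mul]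
  exact le_self_add

/-- **Distinct tail-trivial members of `R_{p,q}` are separated by a tail event** (Georgii 2011, Thm. 7.7 (d):
distinct extremal Gibbs measures are mutually singular on the tail σ-algebra): if `P ≠ P'` are tail-trivial DLR
random-cluster measures carried by lattice configurations (`0 ≤ p ≤ 1`, `q > 0`), there is a tail event `B` with
`P(B) = 1` and `P'(B) = 0`.  Proof: the midpoint `ν = ½P + ½P'` lies in `R_{p,q}` and dominates both; were `ν`
tail-trivial, `eq_of_le_smul_of_isTailTrivial` would give `P = ν = P'`; so some tail event has `ν`-probability in
`(0,1)`, and tail-triviality of `P`, `P'` forces it (or its complement) to separate them. [cite: Georgii2011, Thm. 7.7] -/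
theorem exists_tailEvents_measure_eq_one_and_eq_zero_of_ne (hP : IsDLRRandomCluster d p q P)
    (hP' : IsDLRRandomCluster d p q P₁) (hp : p ∈ Set.Icc (0 : ℝ) 1) (hq : 0 < q)
    (hlat : ∀ᵐ ω ∂P, ω ⊆ (zdGraph d).edgeSet) (hlat' : ∀ᵐ ω ∂P₁, ω ⊆ (zdGraph d).edgeSet)
    (htail : IsTailTrivial (V := Sym2 (Site d)) (S := Prop) P)
    (htail' : IsTailTrivial (V := Sym2 (Site d)) (S := Prop) P₁) (hne : P ≠ P₁) :
    ∃ B : Set (BondConfig (Site d)), MeasurableSet[tailEvents (Sym2 (Site d)) Prop] B ∧ P B = 1 ∧ P₁ B = 0 := by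
  haveI := hP.isProbabilityMeasure
  haveI := hP'.isProbabilityMeasure
  -- the midpoint `ν = ½ P + ½ P'` is a DLR random-cluster measure carried by lattice configurations
  set ν : Measure (BondConfig (Site d)) := (2⁻¹ : ℝ≥0∞) • P + (2⁻¹ : ℝ≥0∞) • P₁ with hν
  have hνDLR : IsDLRRandomCluster d p q ν := by
    refine ⟨⟨?_⟩, fun Λ A hA => ?_⟩
    · simp only [hν, Measure.coe_add, Measure.coe_smul, Pi.add_apply, Pi.smul_apply, smul_eq_mul, measure_univ,
        mul_one, ENNReal.inv_two_add_inv_two]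
    · rw [hν, lintegral_add_measure, lintegral_smul_measure, lintegral_smul_measure, hP.lintegral_rcCondLaw_eq Λ hA,
        hP'.lintegral_rcCondLaw_eq Λ hA]
      simp only [Measure.coe_add, Measure.coe_smul, Pi.add_apply, Pi.smul_apply, smul_eq_mul]
  have hνlat : ∀ᵐ ω ∂ν, ω ⊆ (zdGraph d).edgeSet := by
    rw [hν, ae_add_measure_iff]
    exact ⟨Measure.ae_smul_measure hlat _, Measure.ae_smul_measure hlat' _⟩
  have htwo : (2 : ℝ≥0∞) ≠ ∞ := ENNReal.ofNat_ne_top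
  have hdomP : P ≤ (2 : ℝ≥0∞) • ν := fun s => by
    rw [Measure.smul_apply, smul_eq_mul, hν, Measure.add_apply, Measure.smul_apply, Measure.smul_apply, smul_eq_mul,
      smul_eq_mul, mul_add, ← mul_assoc, ← mul_assoc, ENNReal.mul_inv_cancel two_ne_zero htwo, one_mul, one_mul]
    exact le_self_add
  have hdomP' : P₁ ≤ (2 : ℝ≥0∞) • ν := fun s => by
    rw [Measure.smul_apply, smul_eq_mul, hν, Measure.add_apply, Measure.smul_apply, Measure.smul_apply, smul_eq_mul,
      smul_eq_mul, mul_add, ← mul_assoc, ← mul_assoc, ENNReal.mul_inv_cancel two_ne_zero htwo, one_mul, one_mul]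
    exact le_add_self
  -- `ν` is not tail-trivial (else `P = ν = P'`)
  have hνt : ¬ IsTailTrivial (V := Sym2 (Site d)) (S := Prop) ν := by
    intro hνt
    have h1 : P = ν := hνDLR.eq_of_le_smul_of_isTailTrivial hp hq hνlat hνt hP htwo hdomP
    have h2 : P₁ = ν := hνDLR.eq_of_le_smul_of_isTailTrivial hp hq hνlat hνt hP' htwo hdomP'
    exact hne (h1.trans h2.symm)
  obtain ⟨B, hBt, hB0, hB1⟩ : ∃ B : Set (BondConfig (Site d)),
      MeasurableSet[tailEvents (Sym2 (Site d)) Prop] B ∧ ν B ≠ 0 ∧ ν B ≠ 1 := by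
    by_contra hcon
    refine hνt fun B hB => ?_
    by_contra hB'
    exact hcon ⟨B, hB, fun h0 => hB' (Or.inl h0), fun h1 => hB' (Or.inr h1)⟩
  have hBm : MeasurableSet B := MeasurableSet.of_tailEvents hBt
  have hνB : ν B = 2⁻¹ * P B + 2⁻¹ * P₁ B := by
    rw [hν, Measure.add_apply, Measure.smul_apply, Measure.smul_apply, smul_eq_mul, smul_eq_mul]
  -- `P(B), P'(B) ∈ {0,1}` and `ν(B) ∉ {0,1}` force `{P(B), P'(B)} = {0,1}`
  rcases htail B hBt with hP0 | hP1 <;> rcases htail' B hBt with hQ0 | hQ1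
  · have hP0' : P B = 0 := hP0
    have hQ0' : P₁ B = 0 := hQ0
    refine absurd ?_ hB0
    rw [hνB, hP0', hQ0', mul_zero, add_zero]
  · have hP0' : P B = 0 := hP0
    have hQ1' : P₁ B = 1 := hQ1
    refine ⟨Bᶜ, hBt.compl, ?_, ?_⟩
    · rw [prob_compl_eq_one_iff hBm]; exact hP0'
    · rw [prob_compl_eq_zero_iff hBm]; exact hQ1'
  · have hP1' : P B = 1 := hP1
    have hQ0' : P₁ B = 0 := hQ0
    exact ⟨B, hBt, hP1', hQ0'⟩
  · have hP1' : P B = 1 := hP1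
    have hQ1' : P₁ B = 1 := hQ1
    refine absurd ?_ hB1
    rw [hνB, hP1', hQ1', mul_one, ENNReal.inv_two_add_inv_two]

end IsDLRRandomCluster

/-! ### Grimmett's Thm. (4.34)(c) inside `R_{p,q}`: the box limits admit no dominated DLR measure but themselves -/

section BoxLimits

variable {b : Bool} {P₁ : Measure (BondConfig (Site d))}

/-- **(4.34)(c), domination form, for box limits**: a box limit `P = φ^b_{p,q}` (`0 ≤ p ≤ 1`, `q ≥ 1`) is tail-trivial
(FO-06a-6 `IsBoxLimit.isTailTrivial`), DLR (FO-06b-6 `IsBoxLimit.isDLRRandomCluster`) and carried by lattice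
configurations, so every `P₁ ∈ R_{p,q}` with `P₁ ≤ c • P` (`c < ∞`) equals `P`. [cite: Grimmett2006, Thm. (4.34)(c)] -/
theorem IsBoxLimit.eq_of_isDLRRandomCluster_of_le_smul (hP : IsBoxLimit d b p q P) (hp : p ∈ Set.Icc (0 : ℝ) 1)
    (hq : 1 ≤ q) (h₁ : IsDLRRandomCluster d p q P₁) {c : ℝ≥0∞} (hc : c ≠ ∞) (hdom : P₁ ≤ c • P) : P₁ = P :=
  (hP.isDLRRandomCluster d hp hq).eq_of_le_smul_of_isTailTrivial hp (one_pos.trans_le hq)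
    (hP.ae_subset_edgeSet hp (one_pos.trans_le hq)) (hP.isTailTrivial hp hq) h₁ hc hdom

/-- **(4.34)(c) for `rcLimit d b p q = φ^b_{p,q}`**: every DLR random-cluster measure dominated by `φ^b_{p,q}` is
`φ^b_{p,q}`; in particular `φ^b_{p,q}` is an extreme point of `R_{p,q}` (`0 ≤ p ≤ 1`, `q ≥ 1`, every `d`).
[cite: Grimmett2006, Thm. (4.34)(c)] -/
theorem eq_rcLimit_of_isDLRRandomCluster_of_le_smul (b : Bool) (hp : p ∈ Set.Icc (0 : ℝ) 1) (hq : 1 ≤ q)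
    (h₁ : IsDLRRandomCluster d p q P₁) {c : ℝ≥0∞} (hc : c ≠ ∞) (hdom : P₁ ≤ c • rcLimit d b p q) :
    P₁ = rcLimit d b p q :=
  (isBoxLimit_rcLimit b hp hq).eq_of_isDLRRandomCluster_of_le_smul hp hq h₁ hc hdom

end BoxLimits

/-! ### Positive association of tail-trivial members of `R_{p,q}` for ALL increasing events -/

section Global

/-- **From local to global positive association, for a measure carried by lattice configurations**: if a probability
measure `P` on bond configurations of `ℤ^d` has `P`-a.e. `ω ⊆ 𝔼^d` and satisfies `P(A) P(B) ≤ P(A ∩ B)` for all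
increasing events `A, B` determined by the edges `E_Δ` of some finite region `Δ`, then `P` is positively associated in
the tree's sense (`IsPositivelyAssociated`: ALL measurable increasing events).  Cylinder events over a finite window `J`
of PAIRS are reduced to `E_Δ`-events by `ω ↦ ω ∩ 𝔼^d` (a `P`-a.e. identity; `Δ` = the endpoints of the lattice pairs
of `J`), and Lindqvist's cylinder criterion (`isPositivelyAssociated_pi_of_cylinders`, Grimmett 2006 (4.4)–(4.5))
passes to all increasing events. [cite: Grimmett2006, Prop. (4.10) / (4.4)–(4.5); Lindqvist1988, Thm. 5.1] -/
theorem isPositivelyAssociated_of_forall_edgesIn (P : Measure (BondConfig (Site d))) [IsProbabilityMeasure P]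
    (hlat : ∀ᵐ ω ∂P, ω ⊆ (zdGraph d).edgeSet)
    (h : ∀ (Δ : Finset (Site d)) (A B : Set (BondConfig (Site d))), IsUpperSet A →
      DeterminedBy A ↑(edgesIn (zdGraph d) Δ) → IsUpperSet B → DeterminedBy B ↑(edgesIn (zdGraph d) Δ) →
        P.real A * P.real B ≤ P.real (A ∩ B)) :
    IsPositivelyAssociated P := by
  classical
  haveI : IsProbabilityMeasure (P.map (boolFunEquivSet (Sym2 (Site d))).symm) :=
    Measure.isProbabilityMeasure_map (boolFunEquivSet (Sym2 (Site d))).symm.measurable.aemeasurable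
  refine isPositivelyAssociated_of_map_boolFunEquivSet_symm
    (isPositivelyAssociated_pi_of_cylinders (E := fun _ : Sym2 (Site d) => Bool) _ fun J U V hU hV hUm hVm => ?_)
  have hpre : ∀ W : Set (↥J → Bool), MeasurableSet W →
      (P.map (boolFunEquivSet (Sym2 (Site d))).symm) (J.restrict ⁻¹' W) = P (windowProj J ⁻¹' W) := by
    intro W hW
    rw [Measure.map_apply (boolFunEquivSet (Sym2 (Site d))).symm.measurable
      (hW.preimage (Finset.measurable_restrict J)), ← boolFunEquivSet_symm_preimage_restrict_preimage J W]
  rw [hpre U hUm, hpre V hVm, hpre (U ∩ V) (hUm.inter hVm), Set.preimage_inter]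
  have hwin : ∀ {W : Set (↥J → Bool)}, IsUpperSet W → IsUpperSet (windowProj J ⁻¹' W) := by
    intro W hW ω ω' hle hω
    refine hW (fun j => ?_) hω
    simp only [windowProj_apply]
    rw [Bool.le_iff_imp, decide_eq_true_iff, decide_eq_true_iff]
    exact fun hj => hle hj
  -- lattice reduction `r ω = ω ∩ 𝔼^d`
  set L : Set (Sym2 (Site d)) := (zdGraph d).edgeSet with hL
  set r : BondConfig (Site d) → BondConfig (Site d) := fun ω => ω ∩ L with hr
  have hrae : ∀ᵐ ω ∂P, r ω = ω := by
    filter_upwards [hlat] with ω hω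
    exact Set.inter_eq_left.2 hω
  have hPr : ∀ A : Set (BondConfig (Site d)), P (r ⁻¹' A) = P A := fun A =>
    measure_congr (by
      filter_upwards [hrae] with ω hω
      show (r ω ∈ A) = (ω ∈ A)
      rw [hω])
  set Δ : Finset (Site d) := J.biUnion fun e => (e : Sym2 (Site d)).toFinset with hΔ
  have hdet : ∀ W : Set (↥J → Bool), DeterminedBy (r ⁻¹' (windowProj J ⁻¹' W)) ↑(edgesIn (zdGraph d) Δ) := by
    intro W
    rw [determinedBy_iff]
    intro ω ω' hω
    have hproj : windowProj J (r ω) = windowProj J (r ω') := by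
      funext j
      simp only [windowProj_apply, hr, Set.mem_inter_iff]
      by_cases hjL : (j : Sym2 (Site d)) ∈ L
      · have hjΔ : (j : Sym2 (Site d)) ∈ edgesIn (zdGraph d) Δ := by
          rw [mem_edgesIn_iff]
          refine ⟨hjL, fun z hz => ?_⟩
          rw [hΔ, Finset.mem_biUnion]
          exact ⟨j, j.2, Sym2.mem_toFinset.2 hz⟩
        have hj := Set.ext_iff.1 hω j
        simp only [Set.mem_inter_iff, Finset.mem_coe, hjΔ, and_true] at hj
        simp only [hj]
      · simp only [hjL, and_false]
    simp only [Set.mem_preimage, hproj]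
  have hup : ∀ {W : Set (↥J → Bool)}, IsUpperSet W → IsUpperSet (r ⁻¹' (windowProj J ⁻¹' W)) :=
    fun hW ω ω' hle hω => hwin hW (Set.inter_subset_inter_left L hle) hω
  have key := h Δ _ _ (hup hU) (hdet U) (hup hV) (hdet V)
  rw [← Set.preimage_inter, ← Set.preimage_inter, measureReal_def, measureReal_def, measureReal_def, hPr, hPr,
    hPr, Set.preimage_inter] at key
  calc P (windowProj J ⁻¹' U) * P (windowProj J ⁻¹' V)
      = ENNReal.ofReal ((P (windowProj J ⁻¹' U)).toReal * (P (windowProj J ⁻¹' V)).toReal) := by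
        rw [ENNReal.ofReal_mul ENNReal.toReal_nonneg, ENNReal.ofReal_toReal (measure_ne_top _ _),
          ENNReal.ofReal_toReal (measure_ne_top _ _)]
    _ ≤ ENNReal.ofReal (P (windowProj J ⁻¹' U ∩ windowProj J ⁻¹' V)).toReal := ENNReal.ofReal_le_ofReal key
    _ = P (windowProj J ⁻¹' U ∩ windowProj J ⁻¹' V) := ENNReal.ofReal_toReal (measure_ne_top _ _)

/-- **Grimmett 2006, Prop. (4.37)(c), in the tree's vocabulary**: a TAIL-TRIVIAL DLR random-cluster measure carried by
lattice configurations (`0 ≤ p ≤ 1`, `q ≥ 1`) is positively associated — `IsPositivelyAssociated P`, i.e.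
`P(A) P(B) ≤ P(A ∩ B)` for ALL measurable increasing events (from the `E_Δ`-local form
`IsDLRRandomCluster.real_mul_le_real_inter_of_isTailTrivial` by `isPositivelyAssociated_of_forall_edgesIn`).
[cite: Grimmett2006, Prop. (4.37)(c)] -/
theorem IsDLRRandomCluster.isPositivelyAssociated_of_isTailTrivial (hP : IsDLRRandomCluster d p q P)
    (hp : p ∈ Set.Icc (0 : ℝ) 1) (hq : 1 ≤ q) (hlat : ∀ᵐ ω ∂P, ω ⊆ (zdGraph d).edgeSet)
    (htail : IsTailTrivial (V := Sym2 (Site d)) (S := Prop) P) : IsPositivelyAssociated P := by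
  haveI := hP.isProbabilityMeasure
  exact isPositivelyAssociated_of_forall_edgesIn P hlat fun Δ A B hA hAΔ hB hBΔ =>
    hP.real_mul_le_real_inter_of_isTailTrivial hp hq hlat htail hA hAΔ hB hBΔ

end Global

end Summit.CriticalPhenomena.PercolationContinuityZ3.Theorems.FK

end
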